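import Literature.Probability.LatticeModels.TransferOperator
import Literature.Analysis.UnboundedOperators.SpectralGapProofs
import Literature.MathematicalPhysics.QuantumFieldTheory.LatticeMassGapProofs
import HarnessLib

/-!
# The truncated Cauchy–Schwarz bound for a positive transfer operator: mixed connected correlators are
# controlled by ONE diagonal connected correlator times a truncated norm

Companion of `Literature.Probability.LatticeModels.TransferOperator` (`TransferData`: a positive contraction
`T` with a unit vacuum `Ω`, `T Ω = Ω`; `IsOSRealisation`) and of `LatticeMassGap(Proofs)` (clustering ⇔ gap).
Those files bound the connected matrix element `⟪u, T^t v⟫ − ⟪u, Ω⟫⟪Ω, v⟫` by `‖u‖ ‖v‖ ‖T P_{Ω^⊥}‖^t`, i.e.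
through the SPECTRAL GAP of `T` — a quantity that per-observable clustering hypotheses with observable-dependent
constants (the tree's `QCDScheme.HasLatticeMassGap`, `HasTimeClustering`) do not deliver at a fixed cutoff.
Here we record the gap-free estimate behind the "tree decay" of truncated three-point functions
(Glimm–Jaffe 1987 §6.1, Thm. 6.1.3 (ii)–(iii): `T^t ≥ 0`, Schwarz inequality in the form `⟪·, T^t ·⟫`;
Osterwalder–Seiler 1978 §2; Seiler LNP 159 Ch. 2):

* `TransferData.isPositive_pow` — every power `T^t` of the transfer operator is a positive operator;
* `TransferData.inner_pow_sub_eq` — `⟪u, T^t v⟫ − ⟪u, Ω⟫⟪Ω, v⟫ = ⟪P_{Ω^⊥} u, T^t P_{Ω^⊥} v⟫`;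
* `TransferData.norm_inner_pow_sub_sq_le` — **the truncated Cauchy–Schwarz bound**
  `‖⟪u, T^t v⟫ − ⟪u, Ω⟫⟪Ω, v⟫‖² ≤ (re ⟪u, T^t u⟫ − ‖⟪Ω, u⟫‖²) · (‖v‖² − ‖⟪Ω, v⟫‖²)`:
  the mixed connected correlator of `u` and `v` at time `t` is bounded by the DIAGONAL connected correlator of
  `u` alone at the same time (the only factor that has to decay) times the truncated norm `‖P_{Ω^⊥} v‖²` of `v`
  (no decay needed, no `t`); and its square-root form `norm_inner_pow_sub_le_sqrt_mul_sqrt`;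
* `IsOSRealisation.norm_truncated_sq_le` — the same inequality written for an Osterwalder–Schrader realisation
  of a measure `μ`: `|⟨θF̄ · G∘shift^t⟩ − ⟨θF̄⟩⟨G⟩|² ≤ (Re⟨θF̄ · F∘shift^t⟩ − |⟨F⟩|²) · (⟨θḠ · G⟩ − |⟨G⟩|²)`.

Use (three-point tree decay without a spectral gap).  For a centred three-point function cut by a time
hyperplane into an isolated observable `F` and a pair product `G = A · B`, the left side is the full
three-point function; the first factor on the right is the diagonal two-point function of the single observable
`F` — ONE pair per observable, so finitely many clustering hypotheses (each with its own constant and threshold)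
suffice — and the second is the truncated reflected pair norm of `G`, which a uniform pair bound controls.  No
extraction of the spectral gap from clustering (where observable-dependent thresholds would be fatal) is
involved. [cite: GlimmJaffe1987, §6.1 Thm. 6.1.3] [cite: OsterwalderSeiler1978, §2] [cite: Seiler1982, Ch. 2]
-/

open scoped InnerProductSpace ComplexConjugate
open MeasureTheory

namespace Literature.MathematicalPhysics.QuantumFieldTheory

open Literature.Probability.LatticeModels

section Transfer

variable {H : Type*} [NormedAddCommGroup H] [InnerProductSpace ℂ H] [CompleteSpace H]

omit [CompleteSpace H] in
/-- Powers of the transfer operator are symmetric: `⟪T^t x, y⟫ = ⟪x, T^t y⟫`.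
[cite: GlimmJaffe1987, §6.1 Thm. 6.1.3 (ii)] -/
theorem _root_.Literature.Probability.LatticeModels.TransferData.inner_pow_apply_left
    (D : TransferData H) (t : ℕ) (x y : H) : ⟪(D.T ^ t) x, y⟫_ℂ = ⟪x, (D.T ^ t) y⟫_ℂ :=
  inner_pow_apply_left_eq_right D.isPositive.inner_left_eq_inner_right t x y

omit [CompleteSpace H] in
/-- **Every power of the transfer operator is a positive operator** (`T ≥ 0 ⇒ T^t ≥ 0`: for `t = 2s`,
`⟪T^{2s} x, x⟫ = ‖T^s x‖²`; for `t = 2s+1`, `⟪T^{2s+1} x, x⟫ = ⟪T (T^s x), T^s x⟫ ≥ 0`).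
[cite: GlimmJaffe1987, §6.1 Thm. 6.1.3 (ii)] -/
theorem _root_.Literature.Probability.LatticeModels.TransferData.isPositive_pow (D : TransferData H) (t : ℕ) :
    (D.T ^ t).IsPositive := by
  refine ⟨fun x y => D.inner_pow_apply_left t x y, fun x => ?_⟩
  rw [ContinuousLinearMap.reApplyInnerSelf_apply]
  rcases Nat.even_or_odd' t with ⟨s, rfl | rfl⟩
  · have h : ⟪(D.T ^ (2 * s)) x, x⟫_ℂ = ⟪(D.T ^ s) x, (D.T ^ s) x⟫_ℂ := by
      rw [two_mul, pow_add, mul_apply_eq_comp, D.inner_pow_apply_left]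
    rw [h]
    exact inner_self_nonneg
  · have h : ⟪(D.T ^ (2 * s + 1)) x, x⟫_ℂ = ⟪D.T ((D.T ^ s) x), (D.T ^ s) x⟫_ℂ := by
      rw [show 2 * s + 1 = s + (1 + s) by ring, pow_add, pow_add, pow_one, mul_apply_eq_comp,
        mul_apply_eq_comp, D.inner_pow_apply_left]
    rw [h]
    exact D.isPositive.re_inner_nonneg_left _

/-- The decomposition of a vector along the vacuum line: `v = ⟪Ω, v⟫ Ω + P_{Ω^⊥} v`. [folklore] -/
theorem _root_.Literature.Probability.LatticeModels.TransferData.eq_inner_smul_vacuum_add_proj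
    (D : TransferData H) (v : H) :
    v = ⟪D.vacuum, v⟫_ℂ • D.vacuum + (D.vacuumLine)ᗮ.starProjection v := by
  have h1 := Submodule.starProjection_add_starProjection_orthogonal (K := ℂ ∙ D.vacuum) v
  rw [Submodule.starProjection_unit_singleton (𝕜 := ℂ) D.norm_vacuum v] at h1
  exact h1.symm

/-- The vacuum is orthogonal to `T^t P_{Ω^⊥} v`. [folklore] -/
theorem _root_.Literature.Probability.LatticeModels.TransferData.inner_vacuum_pow_proj
    (D : TransferData H) (t : ℕ) (v : H) :
    ⟪D.vacuum, (D.T ^ t) ((D.vacuumLine)ᗮ.starProjection v)⟫_ℂ = 0 := by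
  have hmem := (D.pow_apply_mem_orthogonal_and_norm_le (Submodule.starProjection_apply_mem _ v) t).1
  rw [TransferData.vacuumLine, Submodule.mem_orthogonal_singleton_iff_inner_right] at hmem
  exact hmem

/-- **Truncation = projection off the vacuum**: `⟪u, T^t v⟫ − ⟪u, Ω⟫⟪Ω, v⟫ = ⟪P_{Ω^⊥} u, T^t P_{Ω^⊥} v⟫`.
[cite: GlimmJaffe1987, §6.1 Thm. 6.1.3] -/
theorem _root_.Literature.Probability.LatticeModels.TransferData.inner_pow_sub_eq (D : TransferData H)
    (u v : H) (t : ℕ) :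
    ⟪u, (D.T ^ t) v⟫_ℂ - ⟪u, D.vacuum⟫_ℂ * ⟪D.vacuum, v⟫_ℂ =
      ⟪(D.vacuumLine)ᗮ.starProjection u, (D.T ^ t) ((D.vacuumLine)ᗮ.starProjection v)⟫_ℂ := by
  set u' := (D.vacuumLine)ᗮ.starProjection u with hu'
  set v' := (D.vacuumLine)ᗮ.starProjection v with hv'
  have hv : (D.T ^ t) v = ⟪D.vacuum, v⟫_ℂ • D.vacuum + (D.T ^ t) v' := by
    conv_lhs => rw [D.eq_inner_smul_vacuum_add_proj v]
    rw [map_add, map_smul, D.pow_apply_vacuum]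
  have hu : u = ⟪D.vacuum, u⟫_ℂ • D.vacuum + u' := D.eq_inner_smul_vacuum_add_proj u
  have h0 : ⟪D.vacuum, (D.T ^ t) v'⟫_ℂ = 0 := D.inner_vacuum_pow_proj t v
  have hΩ : ⟪D.vacuum, D.vacuum⟫_ℂ = 1 := by
    rw [inner_self_eq_norm_sq_to_K, D.norm_vacuum]; simp
  calc ⟪u, (D.T ^ t) v⟫_ℂ - ⟪u, D.vacuum⟫_ℂ * ⟪D.vacuum, v⟫_ℂ
      = ⟪u, ⟪D.vacuum, v⟫_ℂ • D.vacuum + (D.T ^ t) v'⟫_ℂ - ⟪u, D.vacuum⟫_ℂ * ⟪D.vacuum, v⟫_ℂ := by rw [hv]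
    _ = ⟪u, (D.T ^ t) v'⟫_ℂ := by rw [inner_add_right, inner_smul_right]; ring
    _ = ⟪⟪D.vacuum, u⟫_ℂ • D.vacuum + u', (D.T ^ t) v'⟫_ℂ := by rw [← hu]
    _ = ⟪u', (D.T ^ t) v'⟫_ℂ := by rw [inner_add_left, inner_smul_left, h0, mul_zero, zero_add]

omit [CompleteSpace H] in
/-- `re (⟪u, Ω⟫⟪Ω, u⟫) = ‖⟪Ω, u⟫‖²`. [folklore] -/
theorem _root_.Literature.Probability.LatticeModels.TransferData.re_inner_vacuum_mul_self (D : TransferData H)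
    (u : H) : RCLike.re (⟪u, D.vacuum⟫_ℂ * ⟪D.vacuum, u⟫_ℂ) = ‖⟪D.vacuum, u⟫_ℂ‖ ^ 2 := by
  rw [← inner_conj_symm u D.vacuum, RCLike.conj_mul, ← RCLike.ofReal_pow, RCLike.ofReal_re]

/-- The diagonal case of `inner_pow_sub_eq`, real part:
`re ⟪u, T^t u⟫ − ‖⟪Ω, u⟫‖² = re ⟪P u, T^t P u⟫`, `P = P_{Ω^⊥}`. [folklore] -/
theorem _root_.Literature.Probability.LatticeModels.TransferData.re_inner_pow_sub_eq (D : TransferData H)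
    (u : H) (t : ℕ) :
    RCLike.re ⟪u, (D.T ^ t) u⟫_ℂ - ‖⟪D.vacuum, u⟫_ℂ‖ ^ 2 =
      RCLike.re ⟪(D.vacuumLine)ᗮ.starProjection u, (D.T ^ t) ((D.vacuumLine)ᗮ.starProjection u)⟫_ℂ := by
  have h := congrArg RCLike.re (D.inner_pow_sub_eq u u t)
  rwa [map_sub, D.re_inner_vacuum_mul_self] at h

/-- The truncated norm: `‖P_{Ω^⊥} v‖² = ‖v‖² − ‖⟪Ω, v⟫‖²` (Pythagoras along the vacuum line). [folklore] -/
theorem _root_.Literature.Probability.LatticeModels.TransferData.norm_proj_sq_eq (D : TransferData H)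
    (v : H) : ‖(D.vacuumLine)ᗮ.starProjection v‖ ^ 2 = ‖v‖ ^ 2 - ‖⟪D.vacuum, v⟫_ℂ‖ ^ 2 := by
  have h := Submodule.norm_sq_eq_add_norm_sq_starProjection v (ℂ ∙ D.vacuum)
  rw [Submodule.starProjection_unit_singleton (𝕜 := ℂ) D.norm_vacuum v, norm_smul, D.norm_vacuum,
    mul_one] at h
  change ‖v‖ ^ 2 = ‖⟪D.vacuum, v⟫_ℂ‖ ^ 2 + ‖(D.vacuumLine)ᗮ.starProjection v‖ ^ 2 at h
  linarith

/-- The diagonal connected correlator is non-negative: `‖⟪Ω, u⟫‖² ≤ re ⟪u, T^t u⟫` (positivity of `T^t` on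
`P_{Ω^⊥} u`). [cite: GlimmJaffe1987, §6.1 Thm. 6.1.3 (ii)] -/
theorem _root_.Literature.Probability.LatticeModels.TransferData.norm_inner_vacuum_sq_le_re_inner_pow
    (D : TransferData H) (u : H) (t : ℕ) : ‖⟪D.vacuum, u⟫_ℂ‖ ^ 2 ≤ RCLike.re ⟪u, (D.T ^ t) u⟫_ℂ := by
  have h := D.re_inner_pow_sub_eq u t
  have hpos : 0 ≤ RCLike.re ⟪(D.vacuumLine)ᗮ.starProjection u,
      (D.T ^ t) ((D.vacuumLine)ᗮ.starProjection u)⟫_ℂ := by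
    rw [← D.inner_pow_apply_left]
    exact (D.isPositive_pow t).re_inner_nonneg_left _
  linarith

/-- **The truncated Cauchy–Schwarz bound** for a positive transfer operator: for all `u v : H` and `t : ℕ`,
`‖⟪u, T^t v⟫ − ⟪u, Ω⟫⟪Ω, v⟫‖² ≤ (re ⟪u, T^t u⟫ − ‖⟪Ω, u⟫‖²) · (‖v‖² − ‖⟪Ω, v⟫‖²)`.
Proof: truncation is projection off the vacuum (`inner_pow_sub_eq`); Schwarz for the positive operator `T^t`
gives `|⟪Pu, T^t Pv⟫|² ≤ ⟪Pu, T^t Pu⟫ ⟪Pv, T^t Pv⟫`; the first factor is the diagonal connected correlator of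
`u`, the second is at most `‖Pv‖² = ‖v‖² − |⟪Ω, v⟫|²` because `T^t` is a contraction.  The mixed connected
correlator therefore decays as soon as the DIAGONAL correlator of `u` alone does — no spectral gap of `T` is
used. [cite: GlimmJaffe1987, §6.1 Thm. 6.1.3 (ii)–(iii)] [cite: Seiler1982, Ch. 2] -/
theorem _root_.Literature.Probability.LatticeModels.TransferData.norm_inner_pow_sub_sq_le (D : TransferData H)
    (u v : H) (t : ℕ) :
    ‖⟪u, (D.T ^ t) v⟫_ℂ - ⟪u, D.vacuum⟫_ℂ * ⟪D.vacuum, v⟫_ℂ‖ ^ 2 ≤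
      (RCLike.re ⟪u, (D.T ^ t) u⟫_ℂ - ‖⟪D.vacuum, u⟫_ℂ‖ ^ 2) * (‖v‖ ^ 2 - ‖⟪D.vacuum, v⟫_ℂ‖ ^ 2) := by
  set P := (D.vacuumLine)ᗮ.starProjection with hP
  rw [D.inner_pow_sub_eq u v t, D.re_inner_pow_sub_eq u t, ← D.norm_proj_sq_eq v]
  -- Schwarz for the positive operator `T^t`
  have hcs := (D.isPositive_pow t).norm_inner_sq_le (P u) (P v)
  rw [D.inner_pow_apply_left] at hcs
  -- the second factor is at most `‖P v‖²`
  have hA : 0 ≤ RCLike.re ⟪(D.T ^ t) (P u), P u⟫_ℂ := (D.isPositive_pow t).re_inner_nonneg_left _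
  have hB : RCLike.re ⟪(D.T ^ t) (P v), P v⟫_ℂ ≤ ‖P v‖ ^ 2 := by
    have hmem : P v ∈ (D.vacuumLine)ᗮ := Submodule.starProjection_apply_mem _ v
    have hnorm := (D.pow_apply_mem_orthogonal_and_norm_le hmem t).2
    have hg : D.gapNorm ^ t ≤ 1 := pow_le_one₀ D.gapNorm_nonneg D.gapNorm_le_one
    calc RCLike.re ⟪(D.T ^ t) (P v), P v⟫_ℂ ≤ ‖(D.T ^ t) (P v)‖ * ‖P v‖ := re_inner_le_norm _ _
      _ ≤ D.gapNorm ^ t * ‖P v‖ * ‖P v‖ := by gcongr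
      _ ≤ 1 * ‖P v‖ * ‖P v‖ := by gcongr
      _ = ‖P v‖ ^ 2 := by ring
  calc ‖⟪P u, (D.T ^ t) (P v)⟫_ℂ‖ ^ 2
      ≤ RCLike.re ⟪(D.T ^ t) (P u), P u⟫_ℂ * RCLike.re ⟪(D.T ^ t) (P v), P v⟫_ℂ := hcs
    _ ≤ RCLike.re ⟪(D.T ^ t) (P u), P u⟫_ℂ * ‖P v‖ ^ 2 := mul_le_mul_of_nonneg_left hB hA
    _ = RCLike.re ⟪P u, (D.T ^ t) (P u)⟫_ℂ * ‖P v‖ ^ 2 := by rw [D.inner_pow_apply_left]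

/-- Square-root form of the truncated Cauchy–Schwarz bound:
`‖⟪u, T^t v⟫ − ⟪u, Ω⟫⟪Ω, v⟫‖ ≤ √(re ⟪u, T^t u⟫ − ‖⟪Ω, u⟫‖²) · √(‖v‖² − ‖⟪Ω, v⟫‖²)`.
[cite: GlimmJaffe1987, §6.1 Thm. 6.1.3 (ii)–(iii)] -/
theorem _root_.Literature.Probability.LatticeModels.TransferData.norm_inner_pow_sub_le_sqrt_mul_sqrt
    (D : TransferData H) (u v : H) (t : ℕ) :
    ‖⟪u, (D.T ^ t) v⟫_ℂ - ⟪u, D.vacuum⟫_ℂ * ⟪D.vacuum, v⟫_ℂ‖ ≤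
      Real.sqrt (RCLike.re ⟪u, (D.T ^ t) u⟫_ℂ - ‖⟪D.vacuum, u⟫_ℂ‖ ^ 2) *
        Real.sqrt (‖v‖ ^ 2 - ‖⟪D.vacuum, v⟫_ℂ‖ ^ 2) := by
  have h := D.norm_inner_pow_sub_sq_le u v t
  have hA : 0 ≤ RCLike.re ⟪u, (D.T ^ t) u⟫_ℂ - ‖⟪D.vacuum, u⟫_ℂ‖ ^ 2 := by
    linarith [D.norm_inner_vacuum_sq_le_re_inner_pow u t]
  rw [← Real.sqrt_mul hA, Real.le_sqrt (norm_nonneg _)]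
  · exact h
  · have hB : 0 ≤ ‖v‖ ^ 2 - ‖⟪D.vacuum, v⟫_ℂ‖ ^ 2 := by
      rw [← D.norm_proj_sq_eq v]; positivity
    exact mul_nonneg hA hB

/-- **Mixed clustering from diagonal clustering**: if the diagonal connected correlator of `u` decays,
`re ⟪u, T^t u⟫ − ‖⟪Ω, u⟫‖² ≤ C r^t` for all `t`, then for EVERY `v` the mixed connected correlator decays at
half the rate with the explicit constant `√C · √(‖v‖² − ‖⟪Ω, v⟫‖²)`:
`‖⟪u, T^t v⟫ − ⟪u, Ω⟫⟪Ω, v⟫‖ ≤ √C √(‖v‖² − ‖⟪Ω, v⟫‖²) (√r)^t`. [cite: GlimmJaffe1987, §6.1 Thm. 6.1.3] -/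
theorem _root_.Literature.Probability.LatticeModels.TransferData.norm_inner_pow_sub_le_of_diag
    (D : TransferData H) {u : H} {C r : ℝ} (hr : 0 ≤ r)
    (hdiag : ∀ t : ℕ, RCLike.re ⟪u, (D.T ^ t) u⟫_ℂ - ‖⟪D.vacuum, u⟫_ℂ‖ ^ 2 ≤ C * r ^ t) (v : H) (t : ℕ) :
    ‖⟪u, (D.T ^ t) v⟫_ℂ - ⟪u, D.vacuum⟫_ℂ * ⟪D.vacuum, v⟫_ℂ‖ ≤
      Real.sqrt C * Real.sqrt (‖v‖ ^ 2 - ‖⟪D.vacuum, v⟫_ℂ‖ ^ 2) * Real.sqrt r ^ t := by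
  refine (D.norm_inner_pow_sub_le_sqrt_mul_sqrt u v t).trans ?_
  have hpt : Real.sqrt (r ^ t) = Real.sqrt r ^ t := by
    have hsq : r ^ t = (Real.sqrt r ^ t) ^ 2 := by
      rw [← pow_mul, mul_comm, pow_mul, Real.sq_sqrt hr]
    rw [hsq, Real.sqrt_sq (pow_nonneg (Real.sqrt_nonneg r) t)]
  have h1 : Real.sqrt (RCLike.re ⟪u, (D.T ^ t) u⟫_ℂ - ‖⟪D.vacuum, u⟫_ℂ‖ ^ 2) ≤
      Real.sqrt C * Real.sqrt r ^ t := by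
    calc Real.sqrt (RCLike.re ⟪u, (D.T ^ t) u⟫_ℂ - ‖⟪D.vacuum, u⟫_ℂ‖ ^ 2)
        ≤ Real.sqrt (C * r ^ t) := Real.sqrt_le_sqrt (hdiag t)
      _ = Real.sqrt C * Real.sqrt r ^ t := by rw [Real.sqrt_mul' _ (pow_nonneg hr t), hpt]
  calc Real.sqrt (RCLike.re ⟪u, (D.T ^ t) u⟫_ℂ - ‖⟪D.vacuum, u⟫_ℂ‖ ^ 2) *
        Real.sqrt (‖v‖ ^ 2 - ‖⟪D.vacuum, v⟫_ℂ‖ ^ 2)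
      ≤ (Real.sqrt C * Real.sqrt r ^ t) * Real.sqrt (‖v‖ ^ 2 - ‖⟪D.vacuum, v⟫_ℂ‖ ^ 2) :=
        mul_le_mul_of_nonneg_right h1 (Real.sqrt_nonneg _)
    _ = Real.sqrt C * Real.sqrt (‖v‖ ^ 2 - ‖⟪D.vacuum, v⟫_ℂ‖ ^ 2) * Real.sqrt r ^ t := by ring

end Transfer

/-! ### The same bound for an Osterwalder–Schrader realisation of a measure -/

section OS

variable {Ω : Type*} {mΩ : MeasurableSpace Ω}
variable {H : Type*} [NormedAddCommGroup H] [InnerProductSpace ℂ H] [CompleteSpace H]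
variable {μ : Measure Ω} {reflect shift : Ω → Ω} {mpos : MeasurableSpace Ω} {ι : (Ω → ℂ) → H}
  {D : TransferData H}

omit [CompleteSpace H] in
/-- Under an OS realisation the reflected diagonal pairing is the squared norm: `⟨θF̄ · F⟩ = ‖ι F‖²`
(in particular real and non-negative: reflection positivity). [cite: GlimmJaffe1987, §6.1 Thm. 6.1.3] -/
theorem _root_.Literature.Probability.LatticeModels.IsOSRealisation.re_integral_conj_comp_reflect_mul_self
    (hOS : IsOSRealisation (mΩ := mΩ) μ reflect shift mpos ι D) {G : Ω → ℂ}
    (hG : IsBoundedMeasurable mpos G) :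
    RCLike.re (∫ ω, starRingEnd ℂ (G (reflect ω)) * G ω ∂μ) = ‖ι G‖ ^ 2 := by
  rw [← hOS.inner_eq G G hG hG, inner_self_eq_norm_sq]

/-- **The truncated Cauchy–Schwarz bound for a reflection-positive measure with an OS realisation**: for
bounded positive-time observables `F` (the isolated observable, reflected to negative times) and `G` (e.g. a
product of two observables at positive times) and every `t : ℕ`,
`|⟨θF̄ · G∘shift^t⟩ − ⟨θF̄⟩⟨G⟩|² ≤ (Re⟨θF̄ · F∘shift^t⟩ − |⟨F⟩|²) · (⟨θḠ · G⟩ − |⟨G⟩|²)` — the mixed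
connected correlator is bounded by the DIAGONAL connected correlator of `F` at the same time separation times the
truncated reflected pair norm of `G`.  This is the gap-free mechanism of tree decay for truncated three-point
functions: only the two-point clustering of the single observable `F` (one pair) and a uniform bound on the
reflected pair norm of `G` enter. [cite: GlimmJaffe1987, §6.1 Thm. 6.1.3] [cite: OsterwalderSeiler1978, §2] -/
theorem _root_.Literature.Probability.LatticeModels.IsOSRealisation.norm_truncated_sq_le
    (hOS : IsOSRealisation (mΩ := mΩ) μ reflect shift mpos ι D) {F G : Ω → ℂ}
    (hF : IsBoundedMeasurable mpos F) (hG : IsBoundedMeasurable mpos G) (t : ℕ) :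
    ‖(∫ ω, starRingEnd ℂ (F (reflect ω)) * G (shift^[t] ω) ∂μ) -
        (∫ ω, starRingEnd ℂ (F (reflect ω)) ∂μ) * ∫ ω, G ω ∂μ‖ ^ 2 ≤
      (RCLike.re (∫ ω, starRingEnd ℂ (F (reflect ω)) * F (shift^[t] ω) ∂μ) - ‖∫ ω, F ω ∂μ‖ ^ 2) *
        (RCLike.re (∫ ω, starRingEnd ℂ (G (reflect ω)) * G ω ∂μ) - ‖∫ ω, G ω ∂μ‖ ^ 2) := by
  rw [hOS.integral_conj_comp_reflect_mul_comp_iterate hF hG t, hOS.integral_conj_comp_reflect hF,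
    hOS.integral_eq_inner_vacuum hG, hOS.integral_conj_comp_reflect_mul_comp_iterate hF hF t,
    hOS.integral_eq_inner_vacuum hF, hOS.re_integral_conj_comp_reflect_mul_self hG]
  exact D.norm_inner_pow_sub_sq_le (ι F) (ι G) t

/-- **Mixed time-clustering from diagonal time-clustering**, OS form: if the diagonal connected correlator of
the single observable `F` clusters, `Re⟨θF̄ · F∘shift^t⟩ − |⟨F⟩|² ≤ C r^t` (`0 ≤ r`), then for EVERY bounded
positive-time `G`, `|⟨θF̄ · G∘shift^t⟩ − ⟨θF̄⟩⟨G⟩| ≤ √C · √(⟨θḠ·G⟩ − |⟨G⟩|²) · (√r)^t`: the constant of the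
mixed pair is EXPLICIT in the truncated reflected pair norm of `G` (uniform over any family of `G` on which that
norm is uniformly bounded), and its threshold is that of the ONE diagonal pair `(F, F)`.
[cite: GlimmJaffe1987, §6.1 Thm. 6.1.3] [cite: Seiler1982, Ch. 2] -/
theorem _root_.Literature.Probability.LatticeModels.IsOSRealisation.norm_truncated_le_of_diag
    (hOS : IsOSRealisation (mΩ := mΩ) μ reflect shift mpos ι D) {F G : Ω → ℂ}
    (hF : IsBoundedMeasurable mpos F) (hG : IsBoundedMeasurable mpos G) {C r : ℝ} (hr : 0 ≤ r)
    (hdiag : ∀ t : ℕ, RCLike.re (∫ ω, starRingEnd ℂ (F (reflect ω)) * F (shift^[t] ω) ∂μ) -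
      ‖∫ ω, F ω ∂μ‖ ^ 2 ≤ C * r ^ t) (t : ℕ) :
    ‖(∫ ω, starRingEnd ℂ (F (reflect ω)) * G (shift^[t] ω) ∂μ) -
        (∫ ω, starRingEnd ℂ (F (reflect ω)) ∂μ) * ∫ ω, G ω ∂μ‖ ≤
      Real.sqrt C * Real.sqrt (RCLike.re (∫ ω, starRingEnd ℂ (G (reflect ω)) * G ω ∂μ) - ‖∫ ω, G ω ∂μ‖ ^ 2) *
        Real.sqrt r ^ t := by
  rw [hOS.integral_conj_comp_reflect_mul_comp_iterate hF hG t, hOS.integral_conj_comp_reflect hF,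
    hOS.integral_eq_inner_vacuum hG, hOS.re_integral_conj_comp_reflect_mul_self hG]
  refine D.norm_inner_pow_sub_le_of_diag hr (fun s => ?_) (ι G) t
  have h := hdiag s
  rwa [hOS.integral_conj_comp_reflect_mul_comp_iterate hF hF s, hOS.integral_eq_inner_vacuum hF] at h

end OS

end Literature.MathematicalPhysics.QuantumFieldTheory
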